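/-
Copyright (c) 2026 the pub-hodgecm-mathlib formalisation cell (harness21).  Prover seat hodgecm-mathlib-K2E3-p11 (g2), Track B «K2-LIT» ∕ h413,
unit U12 «Characters» of the line `K2_E3_EllipticInputs`, socket #11 `sig_K2E3CharLocIntNearSemisimple`, road (11-SC): the pointwise-limit input `hlim` of
★ `K2E3SupercuspidalCharacterDominatedLimit` ON THE REGULAR ELLIPTIC SET — there the truncated orbital integrals are eventually the full (absolutely convergent)
orbital integral of the coefficient.  2026-09-04.
-/
import Summits.HodgeConjecture.HodgeConjecture.Theorems.K2E3ConjugationJointProperness   -- ★ p856055 (this seat): properness at regular elements with compact centraliser on the CM carriers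
import Mathlib.MeasureTheory.Integral.Bochner.Set
import Mathlib.Topology.Compactness.SigmaCompact
import HarnessLib

/-!
# K2_E3 road (h413 = stmt-HodgeConjecture-24833), unit U12 «Characters», socket #11, road (11-SC) — TRUNCATED ORBITAL INTEGRALS ARE EVENTUALLY CONSTANT
# WHERE THE ORBIT MAP IS PROPER: `∫_{Ω n} c(x g x⁻¹) dν(x) = ∫_G c(x g x⁻¹) dν(x)` for `n ≫ 0`, hence `Θ_n(g) → Θ̃(g)` (Harish-Chandra 1970, Part VII §3 (2) on `G_e`)

Cell `pub/hodgecm-mathlib` (D-0151), Track B (21-frontier RULING «PUSH BOTH» 2026-09-03), socket **`sig_K2E3CharLocIntNearSemisimple`** (SIGS-TABLE-K2E3 row #11, XL),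
road (11-SC) (seat memo §6).  `--supports stmt-HodgeConjecture-24833 --as helper`; theorems only — no `def`, no named fact, no instance, no notation, no `sorry`.

WHAT.  ★ `K2E3SupercuspidalCharacterDominatedLimit.integral_mul_eq_of_truncatedOrbital_tendsto` (this seat) assembles Harish-Chandra's Theorem 16 from two analytic
inputs on the truncated orbital integrals `Θ_n(g) = ∫_{Ω n} c(x g x⁻¹) dν(x)` of a coefficient `c` along a compact exhaustion `(Ω n)`: a pointwise (a.e.) limit `hlim`
and an `L¹_loc` domination.  This file discharges `hlim` on the part of `G` where the orbit map is PROPER — the regular elliptic set [HarishChandra1970, Part VII §3,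
«`lim_{T→∞} Θ_T(γ^y) = F(γ^y)` … as soon as `T ≥ c₁(1+|λ(γ)|)²`», there for all Cartan subgroups via Thm 20; here the elliptic case, where it is elementary]:
if `{x : x g x⁻¹ ∈ tsupport c}` is compact and the exhaustion swallows every compact set (Mathlib `CompactExhaustion.exists_superset_of_isCompact`), then
`∫_{Ω n} c(x g x⁻¹) dν(x) = ∫_G c(x g x⁻¹) dν(x)` for all large `n` (`setIntegral_conj_eq_integral_of_subset`, `eventually_setIntegral_conj_eq_integral`), so
`Θ_n(g) → Θ̃(g) := ∫_G c(x g x⁻¹) dν(x)` (`tendsto_setIntegral_conj`).  §2 reads this on the socket's group `(cmDatum L N H).Local v` at a non-split place for `g`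
regular with compact centraliser (★ p856055 `isCompact_setOf_mem_and_conj_mem_cmDatum_local` with `C₀ = {g}`, `Y = {1}`, `K = {g}`), for ANY compactly supported `c` —
in particular the coefficient `y ↦ B v (ρ y v)` of a supercuspidal class: **`tendsto_setIntegral_conj_cmDatum_local_of_isCompact_centralizer`**.

* §1 `setIntegral_conj_eq_integral_of_subset`, `eventually_setIntegral_conj_eq_integral`, **`tendsto_setIntegral_conj`** (generic).
* §2 `isCompact_setOf_conj_mem_cmDatum_local`, **`tendsto_setIntegral_conj_cmDatum_local_of_isCompact_centralizer`** (CM carriers, non-split `v`).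

HONEST LABEL: HC_CM is proved only modulo the 7 printed citations (2 remaining named inputs: hLiu418 = stmt-HodgeConjecture-24832, h413 =
stmt-HodgeConjecture-24833) until rung 0 closes; this file is an unconditional `--supports` helper; it says nothing off the regular elliptic set (the split-torus
directions of `hlim` are Harish-Chandra's Theorem 20 and remain to be proved).

## References
* [HarishChandra1970] Harish-Chandra (notes by G. van Dijk), *Harmonic Analysis on Reductive p-adic Groups*, LNM 162 (1970), Part V §1 Lemma 19, Thm 12; Part VII §3
  pp. 70–72 (eq. (2)), p. 68.
* [Rogawski1990] J. D. Rogawski, *Automorphic Representations of Unitary Groups in Three Variables*, Ann. of Math. Stud. 123 (1990), §4.9 p. 54.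
-/

set_option autoImplicit false
set_option linter.dupNamespace false

noncomputable section

open MeasureTheory Topology Filter NumberField IsDedekindDomain
open Literature.NumberTheory.Automorphic Literature.NumberTheory.Rogawski1990
open scoped Matrix MatrixGroups

namespace Summit.HodgeConjecture.HodgeConjecture.Cruxes.H413.K2E3TruncatedOrbitalIntegralEventuallyEq

/-! ## §1  Generic: truncations that contain the (compact) support change nothing -/

section Generic

variable {G : Type*} [Group G] [TopologicalSpace G] [MeasurableSpace G] {E : Type*} [NormedAddCommGroup E] [NormedSpace ℝ E]

omit [TopologicalSpace G] in
/-- If `Ω ⊇ {x : x g x⁻¹ ∈ support c}` then `∫_{Ω} c(x g x⁻¹) = ∫_G c(x g x⁻¹)`. [cite: HarishChandra1970, Part VII §3 p. 72] -/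
theorem setIntegral_conj_eq_integral_of_subset (ν : Measure G) (c : G → E) (g : G) {Ω : Set G}
    (h : {x : G | x * g * x⁻¹ ∈ Function.support c} ⊆ Ω) :
    ∫ x in Ω, c (x * g * x⁻¹) ∂ν = ∫ x, c (x * g * x⁻¹) ∂ν := by
  refine setIntegral_eq_integral_of_forall_compl_eq_zero fun x hx => ?_
  by_contra hne
  exact hx (h (Function.mem_support.2 hne))

/-- If `{x : x g x⁻¹ ∈ tsupport c}` is COMPACT and `(Ω n)` is a compact exhaustion of `G`, then `∫_{Ω n} c(x g x⁻¹) = ∫_G c(x g x⁻¹)` for all large `n`.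
[cite: HarishChandra1970, Part VII §3 pp. 70–72] -/
theorem eventually_setIntegral_conj_eq_integral (ν : Measure G) (c : G → E) (g : G) (Ω : CompactExhaustion G)
    (hK : IsCompact {x : G | x * g * x⁻¹ ∈ tsupport c}) :
    ∀ᶠ n in atTop, ∫ x in Ω n, c (x * g * x⁻¹) ∂ν = ∫ x, c (x * g * x⁻¹) ∂ν := by
  obtain ⟨n₀, hn₀⟩ := Ω.exists_superset_of_isCompact hK
  refine (eventually_ge_atTop n₀).mono fun n hn => setIntegral_conj_eq_integral_of_subset ν c g ?_
  intro x hx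
  exact Ω.subset hn (hn₀ (subset_tsupport c hx))

/-- Hence the truncated orbital integrals CONVERGE to the full one: `∫_{Ω n} c(x g x⁻¹) dν(x) → ∫_G c(x g x⁻¹) dν(x)` — the input `hlim` of ★
`K2E3SupercuspidalCharacterDominatedLimit` at such `g`. [cite: HarishChandra1970, Part VII §3 eq. (2)] -/
theorem tendsto_setIntegral_conj (ν : Measure G) (c : G → E) (g : G) (Ω : CompactExhaustion G)
    (hK : IsCompact {x : G | x * g * x⁻¹ ∈ tsupport c}) :
    Tendsto (fun n => ∫ x in Ω n, c (x * g * x⁻¹) ∂ν) atTop (𝓝 (∫ x, c (x * g * x⁻¹) ∂ν)) := by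
  obtain ⟨n₀, hn₀⟩ := (eventually_atTop.1 (eventually_setIntegral_conj_eq_integral ν c g Ω hK))
  exact tendsto_atTop_of_eventually_const (i₀ := n₀) fun n hn => hn₀ n hn

end Generic

/-! ## §2  The socket's group at a non-split place: regular elements with compact centraliser -/

section CM

variable (L : Type) [Field L] [NumberField L] [IsCMField L] (N : ℕ) (H : Matrix (Fin N) (Fin N) L)
  {v : HeightOneSpectrum (𝓞 ↥(maximalRealSubfield L))}

open scoped Classical in
/-- **PROPERNESS OF THE ORBIT MAP OF A REGULAR ELEMENT WITH COMPACT CENTRALISER** on `(cmDatum L N H).Local v` (`v` non-split): `{x : x g x⁻¹ ∈ S}` is compact for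
every compact `S` — ★ p856055 `isCompact_setOf_mem_and_conj_mem_cmDatum_local` with `C₀ = K = {g}`, `Y = {1}`, projected to the first factor.
[cite: HarishChandra1970, Part V §1 Lemma 19; Part I §3 Lemma 14] [cite: Rogawski1990, §4.9 p. 54] -/
theorem isCompact_setOf_conj_mem_cmDatum_local (hH : (H.map (cmConjRingHom L))ᵀ = H) (hHd : IsUnit H.det)
    (w : UnitaryGroup.PlacesOver L v) (hw : IsCMField.complexConj L • w.1 = w.1)
    (g : (UnitaryGroup.cmDatum L N H).Local v) (hg : IsRegularElt (g.val : GL (Fin N) (UnitaryGroup.LocalRing L v)))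
    (hZ : IsCompact ((Subgroup.centralizer ({g} : Set ((UnitaryGroup.cmDatum L N H).Local v)) : Set ((UnitaryGroup.cmDatum L N H).Local v))))
    {S : Set ((UnitaryGroup.cmDatum L N H).Local v)} (hS : IsCompact S) :
    IsCompact {x : (UnitaryGroup.cmDatum L N H).Local v | x * g * x⁻¹ ∈ S} := by
  have hP := K2E3ConjugationJointProperness.isCompact_setOf_mem_and_conj_mem_cmDatum_local L N H hH hHd w hw g hg hZ
    (K := {g}) (S := S) (Y := {1}) (C₀ := {g}) isCompact_singleton
    (fun t ht => by rw [Set.mem_singleton_iff.1 ht]; exact Subgroup.mem_centralizer_singleton_iff.2 rfl)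
    (fun t ht => by rw [Set.mem_singleton_iff.1 ht]; exact hg) hS isCompact_singleton isCompact_singleton
    (fun t ht => ⟨1, rfl, g, rfl, by rw [Set.mem_singleton_iff.1 ht, one_mul, inv_one, mul_one]⟩)
  -- project to the first factor
  have heq : {x : (UnitaryGroup.cmDatum L N H).Local v | x * g * x⁻¹ ∈ S} =
      Prod.fst '' {p : (UnitaryGroup.cmDatum L N H).Local v × (UnitaryGroup.cmDatum L N H).Local v | p.2 ∈ ({g} : Set _) ∧ p.1 * p.2 * p.1⁻¹ ∈ S} := by
    ext x
    constructor
    · intro hx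
      exact ⟨(x, g), ⟨rfl, hx⟩, rfl⟩
    · rintro ⟨⟨x', g'⟩, ⟨hg', hx'⟩, rfl⟩
      rw [Set.mem_singleton_iff.1 hg'] at hx'
      exact hx'
  rw [heq]
  exact hP.image continuous_fst

open scoped Classical in
/-- **`hlim` ON THE REGULAR ELLIPTIC SET**: on `(cmDatum L N H).Local v` (`v` non-split), for `g` regular with compact centraliser, any measure `ν`, any compactly supported
`c` (e.g. the coefficient `y ↦ B v (ρ y v)` of a supercuspidal class) and any compact exhaustion `(Ω n)`:
`∫_{Ω n} c(x g x⁻¹) dν(x) → ∫_G c(x g x⁻¹) dν(x)` — Harish-Chandra's `Θ_ω(γ) = d(ω)∫ θ(γ^x)dx` as the limit of the truncations, at elliptic regular `γ`.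
[cite: HarishChandra1970, Part VII §3 eq. (2); Part VI §1 p. 68] -/
theorem tendsto_setIntegral_conj_cmDatum_local_of_isCompact_centralizer (hH : (H.map (cmConjRingHom L))ᵀ = H) (hHd : IsUnit H.det)
    (w : UnitaryGroup.PlacesOver L v) (hw : IsCMField.complexConj L • w.1 = w.1)
    [MeasurableSpace ((UnitaryGroup.cmDatum L N H).Local v)] (ν : Measure ((UnitaryGroup.cmDatum L N H).Local v))
    {E : Type*} [NormedAddCommGroup E] [NormedSpace ℝ E] (c : (UnitaryGroup.cmDatum L N H).Local v → E) (hc : HasCompactSupport c)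
    (g : (UnitaryGroup.cmDatum L N H).Local v) (hg : IsRegularElt (g.val : GL (Fin N) (UnitaryGroup.LocalRing L v)))
    (hZ : IsCompact ((Subgroup.centralizer ({g} : Set ((UnitaryGroup.cmDatum L N H).Local v)) : Set ((UnitaryGroup.cmDatum L N H).Local v))))
    (Ω : CompactExhaustion ((UnitaryGroup.cmDatum L N H).Local v)) :
    Tendsto (fun n => ∫ x in Ω n, c (x * g * x⁻¹) ∂ν) atTop (𝓝 (∫ x, c (x * g * x⁻¹) ∂ν)) :=
  tendsto_setIntegral_conj ν c g Ω (isCompact_setOf_conj_mem_cmDatum_local L N H hH hHd w hw g hg hZ hc.isCompact)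

end CM

end Summit.HodgeConjecture.HodgeConjecture.Cruxes.H413.K2E3TruncatedOrbitalIntegralEventuallyEq

end
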